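import Summits.CriticalPhenomena.SAWScalingLimit.Theses.SAWWeldingIdentification
import Summits.CriticalPhenomena.SAWScalingLimit.Theses.SAWExcursionCardy
import Summits.CriticalPhenomena.SAWScalingLimit.Theorems.SAWRenewalTightnessEventualTightOfBoundedVirginArc

/-!
# `EventualTight` (stmt-CriticalPhenomena-1372) after the welding-route split (rev 9): the by-name relations of the new bulk child

Crux stmt-CriticalPhenomena-1372 `EventualTight` (shared decl of `SAWRenewalTightness` / `SAWWeldingIdentification` /
`SAWExcursionCardy`), line `Sketch` v9.  The route-level split filed on the bet route `SAWWeldingIdentification` (rev 9),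

    EventualTight (stmt-1372) ⟸ VirginArcTraversalTightBounded (stmt-18042, the registered stub X2c₁ᵇ verbatim)
                               ∧ ConfinementPositivity (stmt-17587),

is re-derived here BY NAME over the route's child decls, from landed theorems only
(`…EventualTightOfBoundedVirginArc.lean`, p151500):

* `EventualTightSWI_of_items` — the split glue over the welding route's decls;
* `VirginArcTraversalTightBounded_of_item` — the unbounded atom item stmt-CriticalPhenomena-17940
  (`SAWExcursionCardy.VirginArcTraversalTight`, all exteriors) implies the bounded child stmt-CriticalPhenomena-18042
  (so closing 17940 still closes everything), via `virginArcTraversalTightBounded_of_finite`;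
* `BulkShellTight_of_boundedItem` — the bounded child implies Renewal's bulk child stmt-CriticalPhenomena-17588
  `SAWRenewalTightness.BulkShellTight`.

Nothing is asserted: both children are research-grade items.  (Strategist s3's `SplitCheckPost.lean`, landed by lead c9.)
[cite: AizenmanBurchardDuke1999, Thm 1.1] [cite: KemppainenSmirnov2017, Thm 1.5]
-/

noncomputable section

namespace Summit.CriticalPhenomena.SAWScalingLimit.Theorems

open Summit.CriticalPhenomena.SAWScalingLimit.Theses

/-- **The crux from the welding route's two children, by name**: `VirginArcTraversalTightBounded`
(stmt-CriticalPhenomena-18042) and `ConfinementPositivity` (stmt-CriticalPhenomena-17587) imply `EventualTight`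
(stmt-CriticalPhenomena-1372) — `eventualTight_of_virginArcTraversalTightBounded_of_confinementPositivity` (p151500) with the
item bodies unfolded definitionally. [folklore] -/
theorem EventualTightSWI_of_items :
    SAWWeldingIdentification.VirginArcTraversalTightBounded → SAWWeldingIdentification.ConfinementPositivity →
      SAWWeldingIdentification.EventualTight :=
  fun hX hE => eventualTight_of_virginArcTraversalTightBounded_of_confinementPositivity hX hE

/-- **stmt-17940 ⟹ stmt-18042, by name**: the all-exteriors atom `SAWExcursionCardy.VirginArcTraversalTight` implies the
bounded-exterior child `SAWWeldingIdentification.VirginArcTraversalTightBounded` (restrict to finite exteriors, then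
`virginArcTraversalTightBounded_of_finite`). [folklore] -/
theorem VirginArcTraversalTightBounded_of_item :
    SAWExcursionCardy.VirginArcTraversalTight → SAWWeldingIdentification.VirginArcTraversalTightBounded :=
  fun hX => virginArcTraversalTightBounded_of_finite fun θ hθ => by
    obtain ⟨k, N₀, hN₀, hk⟩ := hX θ hθ
    exact ⟨k, N₀, hN₀, fun H Λ z₀ N u c u' c' _ hN hV hD hD' => hk H Λ z₀ N u c u' c' hN hV hD hD'⟩

/-- **stmt-18042 ⟹ stmt-17588, by name**: the bounded-exterior child implies Renewal's bulk child
`SAWRenewalTightness.BulkShellTight` (`bulkShellTight_of_virginArcTraversalTightBounded`). [folklore] -/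
theorem BulkShellTight_of_boundedItem :
    SAWWeldingIdentification.VirginArcTraversalTightBounded → SAWRenewalTightness.BulkShellTight :=
  fun hX => bulkShellTight_of_virginArcTraversalTightBounded hX

end Summit.CriticalPhenomena.SAWScalingLimit.Theorems

end
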